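import Summits.QuantumFields.YangMills.Theorems.TwistedTraceScaling.Negative.LabelLimitGuards
import HarnessLib

/-!
# The window-free label limit LIM (⟺ the open stub CMP-2LOOP, R75) is a pure UNIFORMITY statement: pointwise in the lattice size it is a
# theorem, and its two guards stay load-bearing even behind a size threshold — crux disprover, cycle 62 (route `LuscherReduction`,
# crux `TwistedTraceScaling` stmt-QuantumFields-20203; `--supports`, helper only)

R75 (`Negative/UniformAllSizes.lean`) certified `TwoLattice.Stmt.stub_cmpTwoLoop ⟺ LIM`,
  LIM:  `∀ s ε, ∃ Λ0 > 0, ∀ L ≥ 1, ∀ β, 1 ≤ β → 0 < Λ(β, L) → Λ(β, L) ≤ Λ0 → |r_L(β, ⌈sL/Λ(β,L)⌉) − r_𝔥(s)| ≤ ε`,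
and R75b (`Negative/LabelLimitGuards.lean`) showed both guards `1 ≤ β`, `0 < Λ(β, L)` load-bearing.  This file adds:

* ★ `labelLimit_pointwise (L)` — **LIM with `Λ0` allowed to depend on `L` is a THEOREM** (`∀ L, ∀ s ε, ∃ Λ0(L, s, ε) > 0, …`): at fixed `L`,
  `0 < Λ(β, L) ≤ Λ0` with `β ≥ 1` puts `β` in the femto window of depth `Λ/2 ≤ min(1, 1/(4B))`, hence `β ≥ 2/Λ³ ≥ B ≥ β₁(L, s, ε)`
  (✓`BOHandover.beta_ge_of_window`, ✓`Tower.le_of_lam_small`), where `β₁` is S-BASE's threshold (✓`TwoLattice.stub_fixedLatticeTraceLaw`).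
  So the open stub LIM and the theorem `labelLimit_pointwise` differ by EXACTLY ONE QUANTIFIER SWAP, `∀ L ∃ Λ0` (proved) versus `∃ Λ0 ∀ L`
  (open): CMP-2LOOP is the statement that S-BASE's femto thresholds can be taken UNIFORM IN THE LATTICE SIZE when measured in Lüscher's
  two-loop label `Λ(β, L)` — nothing more, nothing less.
* `strongRoot_violates (L) (Λ0)` — on EVERY lattice size the strong-coupling root of `Λ(β, L) = lam` (`lam ≤ Λ0` small) violates the LIM
  inequality at `s = 1`, tolerance `(1 − r_𝔥(1))/4`; hence `labelLimit_false_without_betaGeOne_keeping_threshold`: dropping `1 ≤ β` is NOT repaired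
  by a size threshold `∃ L0(s, ε), ∀ L ≥ L0` (contrast ✓`twistedTraceScaling_false_without_betaGeOne_keeping_threshold`, where the crux's
  threshold depends on the depth `lam` and an `L`-UNIFORM strong-coupling expansion (R73a–b) was needed: LIM has no depth variable, so the
  fixed-`L` kernel sandwich ✓`one_sub_le_traceRatio` suffices).
* `labelLimit_false_without_lambdaPos_keeping_threshold` — dropping `0 < Λ(β, L)` is NOT repaired by a size threshold either: the junk branch
  `Λ(1, L) = 0` holds for EVERY `L ≥ ⌈e^{1/(4b₀)}⌉` (`luscherLambda_one_eq_zero_of_ge`), and the two-`s` argument of R75b runs at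
  `L = max(L0(1), L0(s₂), ⌈e^{1/(4b₀)}⌉)`.

HONEST FRAMING: structural facts about a hypothesis text equivalent to an OPEN stub of a child of the CONDITIONAL reduction route R2b1; the
crux `TwistedTraceScaling` is NOT refuted and NOT closed; fixed-lattice statements only — not infinite volume, not a mass gap, not Clay.
No definitions, no `sorry`.
-/

set_option autoImplicit false

noncomputable section

open MeasureTheory Filter Topology Real
open Literature.MathematicalPhysics.QuantumFieldTheory hiding SU2
open Literature.MathematicalPhysics.QuantumLattice
open Literature.Analysis.OperatorTheory.YMMatrixModel
open scoped BigOperators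

namespace Summit.QuantumFields.YangMills.Theorems.TwistedTraceScaling.Negative

open Summit.QuantumFields.YangMills.Theorems.FemtoTransferGap
open Summit.QuantumFields.YangMills.Theorems.FemtoTransferGap.TraceDoor
open Summit.QuantumFields.YangMills.Theorems.FemtoTransferGap.TT
open Summit.QuantumFields.YangMills.Theorems.FemtoTransferGap.TwoLattice

namespace R75c

/-! ## §1 ★ LIM pointwise in `L` is a theorem (S-BASE): the stub is one quantifier swap away -/

/-- ★ **The label limit at FIXED lattice size is a theorem**: for every `L ≥ 1`, `s > 0`, `ε > 0` there is `Λ0(L, s, ε) > 0` such that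
`|r_L(β, ⌈sL/Λ(β,L)⌉) − r_𝔥(s)| ≤ ε` whenever `β ≥ 1` and `0 < Λ(β, L) ≤ Λ0` — S-BASE (✓`TwoLattice.stub_fixedLatticeTraceLaw`) read through
the window bound `β ≥ 1/(4·(Λ/2)³)` (✓`BOHandover.beta_ge_of_window` at depth `Λ/2`, ✓`Tower.le_of_lam_small`).  The open stub LIM (⟺ `Stmt.stub_cmpTwoLoop`,
R75) is this statement with `Λ0` INDEPENDENT of `L`. [cite: Luscher1983, §3] -/
theorem labelLimit_pointwise (L : ℕ) [NeZero L] :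
    ∀ s : ℝ, 0 < s → ∀ ε : ℝ, 0 < ε → ∃ Λ0 : ℝ, 0 < Λ0 ∧
      ∀ β : ℝ, 1 ≤ β → 0 < luscherLambda β L → luscherLambda β L ≤ Λ0 →
        |traceRatio L β (femtoSteps s β L) - hTraceRatio s| ≤ ε := by
  intro s hs ε hε
  obtain ⟨β1, hβ1⟩ := stub_fixedLatticeTraceLaw L s hs ε hε
  obtain ⟨B, hB⟩ : ∃ B : ℝ, B = max β1 1 := ⟨_, rfl⟩
  have hBpos : 0 < B := by rw [hB]; exact lt_of_lt_of_le one_pos (le_max_right _ _)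
  have hB1 : β1 ≤ B := by rw [hB]; exact le_max_left _ _
  refine ⟨2 * min 1 (1 / (4 * B)), by positivity, fun β hβ hpos hle => hβ1 β ?_⟩
  have hlam : 0 < luscherLambda β L / 2 := by positivity
  have hW : InFemtoWindow (luscherLambda β L / 2) β L := ⟨hβ, by linarith, by linarith⟩
  have h1 : luscherLambda β L / 2 ≤ 1 := by linarith [min_le_left (1 : ℝ) (1 / (4 * B))]
  have h4 : luscherLambda β L / 2 ≤ 1 / (4 * B) := by linarith [min_le_right (1 : ℝ) (1 / (4 * B))]
  exact hB1.trans ((Tower.le_of_lam_small hlam h1 hBpos h4).trans (BOHandover.beta_ge_of_window hlam hW))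

/-- The quantifier swap made explicit: an `L`-UNIFORM `Λ0` (the open stub, in LIM form) trivially gives the pointwise statement; the converse
is CMP-2LOOP's content and is NOT claimed. [folklore] -/
theorem labelLimit_pointwise_of_uniform
    (h : ∀ s : ℝ, 0 < s → ∀ ε : ℝ, 0 < ε → ∃ Λ0 : ℝ, 0 < Λ0 ∧
      ∀ (L : ℕ) [NeZero L], ∀ β : ℝ, 1 ≤ β → 0 < luscherLambda β L → luscherLambda β L ≤ Λ0 →
        |traceRatio L β (femtoSteps s β L) - hTraceRatio s| ≤ ε)
    (L : ℕ) [NeZero L] :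
    ∀ s : ℝ, 0 < s → ∀ ε : ℝ, 0 < ε → ∃ Λ0 : ℝ, 0 < Λ0 ∧
      ∀ β : ℝ, 1 ≤ β → 0 < luscherLambda β L → luscherLambda β L ≤ Λ0 →
        |traceRatio L β (femtoSteps s β L) - hTraceRatio s| ≤ ε := by
  intro s hs ε hε
  obtain ⟨Λ0, hΛ0, H⟩ := h s hs ε hε
  exact ⟨Λ0, hΛ0, H L⟩

/-! ## §2 The strong-coupling root violates LIM on EVERY lattice size; `1 ≤ β` stays load-bearing behind a size threshold -/

/-- **On every lattice size the strong root violates the LIM inequality.**  For `L ≥ 1` and any `Λ0 > 0` there is `0 < β < 1` with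
`0 < Λ(β, L) ≤ Λ0` and `|r_L(β, ⌈L/Λ(β,L)⌉) − r_𝔥(1)| > (1 − r_𝔥(1))/4`: take `lam = min(Λ0, 1/2, g/(4C))` (`g = 1 − r_𝔥(1) > 0`,
`C = 16b₀e^{κ/2}(c_L+1)L/κ`, `κ = b₀/b₁`, `c_L = 2|E|+4|P|`) and the strong root `β ≤ 2b₀e^{κ/2}e^{−κ/lam³}` of `Λ(β, L) = lam`
(✓`exists_strong_window`); then `T = ⌈L/lam⌉ ≤ 2L/lam` and `r_L(β, T) ≥ 1 − 4c_LβT ≥ 1 − C·lam ≥ 1 − g/4` (✓`one_sub_le_traceRatio`,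
`e^{−κ/lam³} ≤ lam³/κ`), so `r_L − r_𝔥(1) ≥ 3g/4`. [folklore] -/
theorem strongRoot_violates (L : ℕ) [NeZero L] {Λ0 : ℝ} (hΛ0 : 0 < Λ0) :
    ∃ β : ℝ, 0 < β ∧ β < 1 ∧ 0 < luscherLambda β L ∧ luscherLambda β L ≤ Λ0 ∧
      (1 - hTraceRatio 1) / 4 < |traceRatio L β (femtoSteps 1 β L) - hTraceRatio 1| := by
  have hr1 : hTraceRatio 1 < 1 := hTraceRatio_lt_one one_pos
  obtain ⟨g, hg⟩ : ∃ g : ℝ, g = 1 - hTraceRatio 1 := ⟨_, rfl⟩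
  have hg0 : 0 < g := by rw [hg]; linarith
  have hb0 : 0 < b0 := by unfold b0; positivity
  have hb1 : 0 < b1 := by unfold b1; positivity
  have hL1 : (1 : ℝ) ≤ (L : ℝ) := by exact_mod_cast NeZero.one_le
  obtain ⟨c1, hc1⟩ : ∃ c1 : ℝ, c1 = 2 * (Fintype.card (Edge 3 L) : ℝ) + 4 * (Fintype.card (Plaquette 3 L) : ℝ) := ⟨_, rfl⟩
  have hc1nn : 0 ≤ c1 := by rw [hc1]; positivity
  obtain ⟨κ, hκ⟩ : ∃ κ : ℝ, κ = b0 / b1 := ⟨_, rfl⟩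
  have hκ0 : 0 < κ := by rw [hκ]; exact div_pos hb0 hb1
  obtain ⟨C, hC⟩ : ∃ C : ℝ, C = 16 * b0 * Real.exp (κ / 2) * (c1 + 1) * L / κ := ⟨_, rfl⟩
  have hC0 : 0 < C := by rw [hC]; positivity
  -- the depth `lam`
  obtain ⟨lam, hlam_pos, hlam_le0, hlam_half, hlam_g⟩ :
      ∃ lam : ℝ, 0 < lam ∧ lam ≤ Λ0 ∧ lam ≤ 1 / 2 ∧ lam ≤ g / (4 * C) :=
    ⟨min Λ0 (min (1 / 2) (g / (4 * C))), lt_min hΛ0 (lt_min (by norm_num) (by positivity)), min_le_left _ _,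
      (min_le_right _ _).trans (min_le_left _ _), (min_le_right _ _).trans (min_le_right _ _)⟩
  have hlam_one : lam ≤ 1 := by linarith
  -- the strong-coupling root with `Λ(β, L) = lam`
  obtain ⟨β, hβ0, hβ1, hβle, hΛ⟩ := exists_strong_window L hlam_pos hlam_one
  refine ⟨β, hβ0, hβ1, by rw [hΛ]; exact hlam_pos, by rw [hΛ]; exact hlam_le0, ?_⟩
  have hfs : femtoSteps 1 β L = ⌈(L : ℝ) / lam⌉₊ := by
    unfold femtoSteps; rw [hΛ]; simp only [one_mul]
  obtain ⟨T, hT⟩ : ∃ T : ℕ, T = ⌈(L : ℝ) / lam⌉₊ := ⟨_, rfl⟩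
  rw [hfs, ← hT]
  -- facts about `T = ⌈L/lam⌉`
  have hinv : 2 ≤ 1 / lam := by rw [le_div_iff₀ hlam_pos]; linarith
  have hLl : (1 : ℝ) / lam ≤ (L : ℝ) / lam := div_le_div_of_nonneg_right hL1 hlam_pos.le
  have hceil : (L : ℝ) / lam ≤ T := by rw [hT]; exact Nat.le_ceil _
  have hceil' : (T : ℝ) < (L : ℝ) / lam + 1 := by rw [hT]; exact Nat.ceil_lt_add_one (by positivity)
  have hT1 : 1 ≤ T := by
    have : (1 : ℝ) ≤ (T : ℝ) := by linarith
    exact_mod_cast this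
  have hTle : (T : ℝ) ≤ 2 * L / lam := by
    have : (2 : ℝ) * L / lam = (L : ℝ) / lam + (L : ℝ) / lam := by ring
    linarith
  -- the lattice side at the strong root: `r ≥ 1 − 4 c₁ β T ≥ 1 − g/4`
  have hlow := one_sub_le_traceRatio L hβ0.le hT1
  rw [← hc1] at hlow
  have hsmall : 4 * (c1 * β) * T ≤ g / 4 := by
    have he : Real.exp (-(b0 / b1) * (1 / lam ^ 3 - 1 / 2)) = Real.exp (κ / 2) * Real.exp (-(κ / lam ^ 3)) := by
      rw [← Real.exp_add, hκ]; congr 1; ring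
    have hx : 0 < κ / lam ^ 3 := by positivity
    have hex : Real.exp (-(κ / lam ^ 3)) ≤ lam ^ 3 / κ := by
      have h1 : κ / lam ^ 3 + 1 ≤ Real.exp (κ / lam ^ 3) := Real.add_one_le_exp _
      rw [Real.exp_neg]
      calc (Real.exp (κ / lam ^ 3))⁻¹ ≤ (κ / lam ^ 3)⁻¹ := inv_anti₀ hx (by linarith)
        _ = lam ^ 3 / κ := by rw [inv_div]
    have hβ' : β ≤ 2 * b0 * Real.exp (κ / 2) * (lam ^ 3 / κ) := by
      calc β ≤ 2 * b0 * Real.exp (-(b0 / b1) * (1 / lam ^ 3 - 1 / 2)) := hβle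
        _ = 2 * b0 * Real.exp (κ / 2) * Real.exp (-(κ / lam ^ 3)) := by rw [he]; ring
        _ ≤ 2 * b0 * Real.exp (κ / 2) * (lam ^ 3 / κ) := mul_le_mul_of_nonneg_left hex (by positivity)
    calc 4 * (c1 * β) * T ≤ 4 * (c1 * (2 * b0 * Real.exp (κ / 2) * (lam ^ 3 / κ))) * (2 * L / lam) := by
          apply mul_le_mul _ hTle (by positivity) (by positivity)
          exact mul_le_mul_of_nonneg_left (mul_le_mul_of_nonneg_left hβ' hc1nn) (by norm_num)
      _ = (16 * b0 * Real.exp (κ / 2) * c1 * L / κ) * lam ^ 2 := by field_simp; ring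
      _ ≤ C * lam ^ 2 := by
          apply mul_le_mul_of_nonneg_right _ (by positivity)
          rw [hC]
          apply div_le_div_of_nonneg_right _ hκ0.le
          apply mul_le_mul_of_nonneg_right _ (by positivity)
          exact mul_le_mul_of_nonneg_left (by linarith) (by positivity)
      _ ≤ C * lam := by
          apply mul_le_mul_of_nonneg_left _ hC0.le
          have h1 : lam ^ 2 = lam * lam := by ring
          rw [h1]
          exact mul_le_of_le_one_right hlam_pos.le hlam_one
      _ ≤ C * (g / (4 * C)) := mul_le_mul_of_nonneg_left hlam_g hC0.le
      _ = g / 4 := by field_simp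
  have h3 : g / 4 < traceRatio L β T - hTraceRatio 1 := by linarith only [hlow, hsmall, hg, hg0]
  rw [hg] at h3
  exact lt_of_lt_of_le h3 (le_abs_self _)

/-- **LIM without `1 ≤ β` stays false behind a size threshold `∃ L0(s, ε), ∀ L ≥ L0`**: at `s = 1`, `ε = (1 − r_𝔥(1))/4` the strong root on the
lattice `L = max(L0, 1)` violates it (`strongRoot_violates`).  (LIM has no depth variable, so — unlike the crux, ✓R73c — the threshold cannot
depend on `lam` and no `L`-uniform expansion is needed.) [folklore] -/
theorem labelLimit_false_without_betaGeOne_keeping_threshold :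
    ¬ (∀ s : ℝ, 0 < s → ∀ ε : ℝ, 0 < ε → ∃ Λ0 : ℝ, 0 < Λ0 ∧ ∃ L0 : ℕ,
        ∀ (L : ℕ) [NeZero L], L0 ≤ L → ∀ β : ℝ, 0 < luscherLambda β L → luscherLambda β L ≤ Λ0 →
          |traceRatio L β (femtoSteps s β L) - hTraceRatio s| ≤ ε) := by
  intro h
  have hg : 0 < (1 - hTraceRatio 1) / 4 := by linarith [hTraceRatio_lt_one one_pos]
  obtain ⟨Λ0, hΛ0, L0, H⟩ := h 1 one_pos _ hg
  haveI : NeZero (max L0 1) := ⟨(lt_max_of_lt_right Nat.one_pos).ne'⟩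
  obtain ⟨β, -, -, hpos, hle, hviol⟩ := strongRoot_violates (max L0 1) hΛ0
  exact absurd (H (max L0 1) (le_max_left _ _) β hpos hle) (not_le.mpr hviol)

/-! ## §3 The junk branch `Λ = 0` persists at every large `L`; `0 < Λ(β, L)` stays load-bearing behind a size threshold -/

/-- The junk branch at `β = 1` holds on EVERY lattice `L ≥ ⌈e^{1/(4b₀)}⌉`: `log L ≥ 1/(4b₀)` ⇒ `1/ḡ²(1, L) ≤ 0` ⇒ `Λ(1, L) = 0`. [folklore] -/
theorem luscherLambda_one_eq_zero_of_ge {L : ℕ} (hL : ⌈Real.exp (1 / (4 * b0))⌉₊ ≤ L) : luscherLambda 1 L = 0 := by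
  apply R75b.luscherLambda_eq_zero_of_invRunningCoupling_nonpos
  apply R75b.invRunningCoupling_nonpos_of_log_ge (by simpa using BOHandover.two_mul_b0_le_one)
  have h1 : Real.exp (1 / (4 * b0)) ≤ (L : ℝ) := (Nat.le_ceil _).trans (by exact_mod_cast hL)
  calc (1 : ℝ) / (4 * b0) = Real.log (Real.exp (1 / (4 * b0))) := (Real.log_exp _).symm
    _ ≤ _ := Real.log_le_log (Real.exp_pos _) h1

/-- **LIM without `0 < Λ(β, L)` stays false behind a size threshold `∃ L0(s, ε), ∀ L ≥ L0`**: the two-`s` argument of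
✓`R75b.labelLimit_false_without_lambdaPos` on the junk lattice `β = 1`, `L = max(L0(1), L0(s₂), ⌈e^{1/(4b₀)}⌉)` (`Λ = 0`, `T = 0` for both `s`). [folklore] -/
theorem labelLimit_false_without_lambdaPos_keeping_threshold :
    ¬ (∀ s : ℝ, 0 < s → ∀ ε : ℝ, 0 < ε → ∃ Λ0 : ℝ, 0 < Λ0 ∧ ∃ L0 : ℕ,
        ∀ (L : ℕ) [NeZero L], L0 ≤ L → ∀ β : ℝ, 1 ≤ β → luscherLambda β L ≤ Λ0 →
          |traceRatio L β (femtoSteps s β L) - hTraceRatio s| ≤ ε) := by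
  intro h
  have hr1 : 0 < hTraceRatio 1 := hTraceRatio_pos one_pos
  obtain ⟨s₀, hs₀, hsmall⟩ := hTraceRatio_lt_of_small (c := hTraceRatio 1 / 3) (by positivity)
  obtain ⟨s₂, hs₂def⟩ : ∃ s₂ : ℝ, s₂ = min s₀ 1 := ⟨_, rfl⟩
  have hs₂ : 0 < s₂ := by rw [hs₂def]; exact lt_min hs₀ one_pos
  have hr2 : hTraceRatio s₂ < hTraceRatio 1 / 3 := hsmall s₂ hs₂ (by rw [hs₂def]; exact min_le_left _ _)
  obtain ⟨Λ1, hΛ1, L1, H1⟩ := h 1 one_pos (hTraceRatio 1 / 4) (by positivity)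
  obtain ⟨Λ2, hΛ2, L2, H2⟩ := h s₂ hs₂ (hTraceRatio 1 / 4) (by positivity)
  obtain ⟨L, hL⟩ : ∃ L : ℕ, L = max (max L1 L2) ⌈Real.exp (1 / (4 * b0))⌉₊ := ⟨_, rfl⟩
  have hLN : ⌈Real.exp (1 / (4 * b0))⌉₊ ≤ L := by rw [hL]; exact le_max_right _ _
  have hLpos : 0 < L := lt_of_lt_of_le (Nat.ceil_pos.mpr (Real.exp_pos _)) hLN
  haveI : NeZero L := ⟨hLpos.ne'⟩
  have hΛ : luscherLambda 1 L = 0 := luscherLambda_one_eq_zero_of_ge hLN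
  have h1 := H1 L (by rw [hL]; exact (le_max_left _ _).trans (le_max_left _ _)) 1 le_rfl (by rw [hΛ]; exact hΛ1.le)
  have h2 := H2 L (by rw [hL]; exact (le_max_right _ _).trans (le_max_left _ _)) 1 le_rfl (by rw [hΛ]; exact hΛ2.le)
  rw [R75b.femtoSteps_eq_zero_of_luscherLambda_eq_zero hΛ] at h1 h2
  have e1 := (abs_le.mp h1).1
  have e2 := (abs_le.mp h2).2
  linarith

end R75c

end Summit.QuantumFields.YangMills.Theorems.TwistedTraceScaling.Negative

end
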